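import Summits.CriticalPhenomena.PercolationContinuityZ3.Theorems.PercNearOneGluingNoHeavyLowerTailSahiE3LevelZ2LPrime
import Mathlib.Tactic.Linarith
import Mathlib.Tactic.Ring
import HarnessLib
import HarnessLib.Audit

/-!
# `NoHeavyLowerTail` (crux stmt-CriticalPhenomena-4575), Sahi programme P4: the level-`z₂` mixed block —
# the `R`-free member `F_S ≥ 0` on the `K₀`-null sub-universe W4, from Sahi's `C₃` on the block (unconditional on Bool³ / Bool⁴)

Support file (cell `prim-l12`, seat P4, generation 31; `--supports stmt-CriticalPhenomena-4575`).  No named facts, no sorries;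
standard axioms; def-free.

Context (HOME prim-l12-p4/FROM-prim-l12-p4-gen30-MIXED-BLOCK-STRUCTURE.md R8, STATUS 217–223).  The level-`z₂` mixed block
`MU = c₀ + R(K₀K₀'V) + R(L₁L₁'V)` (twisted configuration `Σ = (O₀,K₀,L₁,P₁; O₀',K₀',L₁',P₁')` of a two-column up-set configuration
`O ⊆ K∩L, K∪L ⊆ P` of `B × Bool`, slot `V ⊆ B`, block weight `w ≥ 0` of mass `1`, e-brackets MU1/MU2 of the `D₂` blocks) is assembled
by `…SahiE3LevelZ2MixedCore.mixed_core` from three members; the `R`-free member is `F_S = c₀ + need(K₀,K₀') + need(L₁,L₁')`.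
On the sub-universe **W4** (`K₀ = O₀ = ∅`, `L₀ = P₀ =: Q ⊆ S := L₁ = P₁ ⊇ K := K₁ = O₁`, primed column constant across the two
layers with `Y := K'`, `Z := L'`, `P' = Y ∪ Z`, `O' = ∅`) gen 30 computed (symbolically, `code/gen30/pp.py`; re-verified by gen 31
against the definition in exact rationals on 800 random instances for both brackets MU1, MU2: `lab/t_w4formula.py`) the closed form
  `F_S = (2−v)w(S∩W) + (2−v)a(Q∩W) − v·c(Q∩W) − w(W)a(K) + a(K∩Y) + (1−v)w(K∩Y) − (1−v)w(K)w(W) + a(Q∩Z) − w(K)a(Z) − w(Y)a(Q)`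
  `       − (1−v)w(Y)w(Q) − w(S)c(Z) − w(S)(a(Y) − v·w(Y)) + (w(Z) − w(Y))a(S)`,   `W := Y ∪ Z`,
(`v = w(V)`, `a(X) = w(X∩V)`, `c(X) = w(X) − w(X∩V)`).  THEOREM `fS_W4_nonneg_of_latticeE3`: this is `≥ 0` given four Harris
instances on the block and ONE instance of Sahi's `C₃`, `0 ≤ latticeE3 w Q (Y∪Z) V`; the proof is the exact decomposition
  `F_S = L′(Q,Y,Z,V) + [a(KY) − y·a(K)] + (1−v)[w(KY) − k·y] + (2−v)[w(SW) − s·w(W)] + w(Z∖Y)(a(S) − a(K)) + (1−v)w(Z∖Y)(s − k)`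
  `       + a(Z)(s − k) + w(Y∖Z)·c(S) + (s − q)·c(Y)`          (`fS_W4_eq`)
with every bracket nonnegative and `L′ ≥ 0` by `…SahiE3LevelZ2LPrime.lprime_nonneg_of_latticeE3` (gen 31, p522256).  Hence
`F_S ≥ 0` on W4 for every FKG probability weight on a finite distributive lattice GIVEN that `C₃` instance
(`fS_W4_nonneg_of_fkg`), and UNCONDITIONALLY on the flagship block `{0,1}³` and on `{0,1}⁴` (`fS_W4_nonneg_cube_three`,
`fS_W4_nonneg_cube_four`).  This closes the W4 sub-case of the `K₀`-null case named in gen 30's census; the remaining `K₀`-null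
universes (U3, U4, V2, V5) are being searched with `E₃` atoms (kit `lab/kit3e`). [this work]
-/

namespace Summit.CriticalPhenomena.PercolationContinuityZ3.Theorems.SahiE3LevelZ2FSW4

open Finset Literature.Probability.LatticeModels SahiE3LevelZ2LPrime
open scoped BigOperators

variable {B : Type*} [Fintype B] [DecidableEq B]

omit [Fintype B] in
/-- **Exact decomposition of `F_S` on W4** (pure algebra; the two set identities `w(Y∪Z) = w(Z∖Y) + w(Y) = w(Y∖Z) + w(Z)`
are the only input). [this work] -/
theorem fS_W4_eq (w : B → ℝ) (S Q K Y Z V : Finset B) :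
    (2 - mass w V) * mass w (S ∩ (Y ∪ Z)) + (2 - mass w V) * mass w (Q ∩ (Y ∪ Z) ∩ V)
        - mass w V * (mass w (Q ∩ (Y ∪ Z)) - mass w (Q ∩ (Y ∪ Z) ∩ V)) - mass w (Y ∪ Z) * mass w (K ∩ V)
        + mass w (K ∩ Y ∩ V) + (1 - mass w V) * mass w (K ∩ Y) - (1 - mass w V) * mass w K * mass w (Y ∪ Z)
        + mass w (Q ∩ Z ∩ V) - mass w K * mass w (Z ∩ V) - mass w Y * mass w (Q ∩ V) - (1 - mass w V) * mass w Y * mass w Q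
        - mass w S * (mass w Z - mass w (Z ∩ V)) - mass w S * (mass w (Y ∩ V) - mass w V * mass w Y)
        + (mass w Z - mass w Y) * mass w (S ∩ V)
      = ((2 - mass w V) * mass w (Q ∩ (Y ∪ Z) ∩ V) - mass w V * (mass w (Q ∩ (Y ∪ Z)) - mass w (Q ∩ (Y ∪ Z) ∩ V))
          + mass w (Q ∩ Z ∩ V) - mass w Y * mass w (Q ∩ V) - (1 - mass w V) * mass w Y * mass w Q
          + mass w Q * (mass w Y - mass w (Y ∩ V)))
        + (mass w (K ∩ Y ∩ V) - mass w Y * mass w (K ∩ V))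
        + (1 - mass w V) * (mass w (K ∩ Y) - mass w K * mass w Y)
        + (2 - mass w V) * (mass w (S ∩ (Y ∪ Z)) - mass w S * mass w (Y ∪ Z))
        + mass w (Z \ Y) * (mass w (S ∩ V) - mass w (K ∩ V))
        + (1 - mass w V) * mass w (Z \ Y) * (mass w S - mass w K)
        + mass w (Z ∩ V) * (mass w S - mass w K)
        + mass w (Y \ Z) * (mass w S - mass w (S ∩ V))
        + (mass w S - mass w Q) * (mass w Y - mass w (Y ∩ V)) := by
  have h1 : mass w (Z \ Y) = mass w (Y ∪ Z) - mass w Y := by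
    have := mass_union_eq_sdiff_add w Y Z; linarith
  have h2 : mass w (Y \ Z) = mass w (Y ∪ Z) - mass w Z := by
    have := mass_union_eq_sdiff_add w Z Y; rw [Finset.union_comm] at this; linarith
  rw [h1, h2]; ring

/-- **`F_S ≥ 0` on W4 from one `C₃` instance and Harris.**  `w ≥ 0` of mass `1` on a finite type; sets `S ⊇ Q`, `S ⊇ K` (as the mass
inequalities actually used), `Y, Z, V`; Harris instances `y·a(K) ≤ a(K∩Y)`, `k·y ≤ w(K∩Y)`, `s·w(Y∪Z) ≤ w(S∩(Y∪Z))`, `q·v ≤ a(Q)`; and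
`0 ≤ latticeE3 w Q (Y∪Z) V`.  Then the W4 closed form of `F_S` (module docstring) is nonnegative. [this work] -/
theorem fS_W4_nonneg_of_latticeE3 (w : B → ℝ) (hw : ∀ b, 0 ≤ w b) (hw1 : ∑ b, w b = 1) (S Q K Y Z V : Finset B)
    (hQS : mass w Q ≤ mass w S) (hKS : mass w K ≤ mass w S) (hKSV : mass w (K ∩ V) ≤ mass w (S ∩ V))
    (h1 : mass w Y * mass w (K ∩ V) ≤ mass w (K ∩ Y ∩ V)) (h2 : mass w K * mass w Y ≤ mass w (K ∩ Y))
    (h3 : mass w S * mass w (Y ∪ Z) ≤ mass w (S ∩ (Y ∪ Z))) (hQV : mass w Q * mass w V ≤ mass w (Q ∩ V))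
    (hC3 : 0 ≤ latticeE3 w Q (Y ∪ Z) V) :
    0 ≤ (2 - mass w V) * mass w (S ∩ (Y ∪ Z)) + (2 - mass w V) * mass w (Q ∩ (Y ∪ Z) ∩ V)
        - mass w V * (mass w (Q ∩ (Y ∪ Z)) - mass w (Q ∩ (Y ∪ Z) ∩ V)) - mass w (Y ∪ Z) * mass w (K ∩ V)
        + mass w (K ∩ Y ∩ V) + (1 - mass w V) * mass w (K ∩ Y) - (1 - mass w V) * mass w K * mass w (Y ∪ Z)
        + mass w (Q ∩ Z ∩ V) - mass w K * mass w (Z ∩ V) - mass w Y * mass w (Q ∩ V) - (1 - mass w V) * mass w Y * mass w Q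
        - mass w S * (mass w Z - mass w (Z ∩ V)) - mass w S * (mass w (Y ∩ V) - mass w V * mass w Y)
        + (mass w Z - mass w Y) * mass w (S ∩ V) := by
  have hw0 : 0 ≤ w := fun b => hw b
  have hu : mass w univ = 1 := by rw [mass_univ]; exact hw1
  have hv1 : mass w V ≤ 1 := by have := mass_mono hw0 (Finset.subset_univ V); rwa [hu] at this
  have hL := lprime_nonneg_of_latticeE3 w hw hw1 Q Y Z V hQV hC3
  have hSV : mass w (S ∩ V) ≤ mass w S := mass_mono hw0 Finset.inter_subset_left
  have hYV : mass w (Y ∩ V) ≤ mass w Y := mass_mono hw0 Finset.inter_subset_left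
  have t4 : 0 ≤ mass w (Z \ Y) * (mass w (S ∩ V) - mass w (K ∩ V)) :=
    mul_nonneg (mass_nonneg hw0 _) (sub_nonneg.2 hKSV)
  have t5 : 0 ≤ (1 - mass w V) * mass w (Z \ Y) * (mass w S - mass w K) :=
    mul_nonneg (mul_nonneg (sub_nonneg.2 hv1) (mass_nonneg hw0 _)) (sub_nonneg.2 hKS)
  have t6 : 0 ≤ mass w (Z ∩ V) * (mass w S - mass w K) := mul_nonneg (mass_nonneg hw0 _) (sub_nonneg.2 hKS)
  have t7 : 0 ≤ mass w (Y \ Z) * (mass w S - mass w (S ∩ V)) := mul_nonneg (mass_nonneg hw0 _) (sub_nonneg.2 hSV)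
  have t8 : 0 ≤ (mass w S - mass w Q) * (mass w Y - mass w (Y ∩ V)) :=
    mul_nonneg (sub_nonneg.2 hQS) (sub_nonneg.2 hYV)
  have t2 : 0 ≤ (1 - mass w V) * (mass w (K ∩ Y) - mass w K * mass w Y) :=
    mul_nonneg (sub_nonneg.2 hv1) (sub_nonneg.2 h2)
  have t3 : 0 ≤ (2 - mass w V) * (mass w (S ∩ (Y ∪ Z)) - mass w S * mass w (Y ∪ Z)) :=
    mul_nonneg (by linarith) (sub_nonneg.2 h3)
  rw [fS_W4_eq]
  linarith

/-- **`F_S ≥ 0` on W4 for an FKG weight, conditional on one `C₃` instance.**  `w ≥ 0` log-supermodular of mass `1` on a finite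
distributive lattice, up-sets `Q ⊆ S ⊇ K`, `Y, Z, V`; if `0 ≤ latticeE3 w Q (Y∪Z) V` then the W4 closed form of `F_S` is
nonnegative (the Harris instances are Mathlib's four-functions theorem via `Literature…fkg_upperSet_mass`). [this work] -/
theorem fS_W4_nonneg_of_fkg {L : Type*} [DistribLattice L] [Fintype L] [DecidableEq L] (w : L → ℝ) (hw : ∀ b, 0 ≤ w b)
    (hfkg : ∀ a b, w a * w b ≤ w (a ⊓ b) * w (a ⊔ b)) (hw1 : ∑ b, w b = 1) (S Q K Y Z V : Finset L)
    (hQS : Q ⊆ S) (hKS : K ⊆ S) (hS : IsUpperSet (S : Set L)) (hQ : IsUpperSet (Q : Set L)) (hK : IsUpperSet (K : Set L))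
    (hY : IsUpperSet (Y : Set L)) (hZ : IsUpperSet (Z : Set L)) (hV : IsUpperSet (V : Set L))
    (hC3 : 0 ≤ latticeE3 w Q (Y ∪ Z) V) :
    0 ≤ (2 - mass w V) * mass w (S ∩ (Y ∪ Z)) + (2 - mass w V) * mass w (Q ∩ (Y ∪ Z) ∩ V)
        - mass w V * (mass w (Q ∩ (Y ∪ Z)) - mass w (Q ∩ (Y ∪ Z) ∩ V)) - mass w (Y ∪ Z) * mass w (K ∩ V)
        + mass w (K ∩ Y ∩ V) + (1 - mass w V) * mass w (K ∩ Y) - (1 - mass w V) * mass w K * mass w (Y ∪ Z)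
        + mass w (Q ∩ Z ∩ V) - mass w K * mass w (Z ∩ V) - mass w Y * mass w (Q ∩ V) - (1 - mass w V) * mass w Y * mass w Q
        - mass w S * (mass w Z - mass w (Z ∩ V)) - mass w S * (mass w (Y ∩ V) - mass w V * mass w Y)
        + (mass w Z - mass w Y) * mass w (S ∩ V) := by
  have hw0 : 0 ≤ w := fun b => hw b
  have hu : mass w univ = 1 := by rw [mass_univ]; exact hw1
  have hKV : IsUpperSet ((K ∩ V : Finset L) : Set L) := by rw [Finset.coe_inter]; exact hK.inter hV
  have hYZ : IsUpperSet ((Y ∪ Z : Finset L) : Set L) := by rw [Finset.coe_union]; exact hY.union hZ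
  have h1 := fkg_upperSet_mass hw0 hfkg hY hKV
  have h2 := fkg_upperSet_mass hw0 hfkg hK hY
  have h3 := fkg_upperSet_mass hw0 hfkg hS hYZ
  have hQV' := fkg_upperSet_mass hw0 hfkg hQ hV
  rw [hu, one_mul] at h1 h2 h3 hQV'
  have e1 : Y ∩ (K ∩ V) = K ∩ Y ∩ V := by
    ext b; simp only [Finset.mem_inter]; tauto
  rw [e1] at h1
  exact fS_W4_nonneg_of_latticeE3 w hw hw1 S Q K Y Z V (mass_mono hw0 hQS) (mass_mono hw0 hKS)
    (mass_mono hw0 (Finset.inter_subset_inter_right hKS)) (by linarith [h1]) h2 h3 hQV' hC3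

/-- **`F_S ≥ 0` on W4, unconditionally on the flagship block `{0,1}³`** (every FKG probability weight; `Q ⊆ S ⊇ K`, `Y, Z, V` up-sets):
the `C₃` instance is `…SahiC3Cube.latticeE3_nonneg_cube_three`. [this work] -/
theorem fS_W4_nonneg_cube_three (w : (Fin 3 → Bool) → ℝ) (hw : ∀ b, 0 ≤ w b)
    (hfkg : ∀ a b, w a * w b ≤ w (a ⊓ b) * w (a ⊔ b)) (hw1 : ∑ b, w b = 1) (S Q K Y Z V : Finset (Fin 3 → Bool))
    (hQS : Q ⊆ S) (hKS : K ⊆ S) (hS : IsUpperSet (S : Set (Fin 3 → Bool))) (hQ : IsUpperSet (Q : Set (Fin 3 → Bool)))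
    (hK : IsUpperSet (K : Set (Fin 3 → Bool))) (hY : IsUpperSet (Y : Set (Fin 3 → Bool)))
    (hZ : IsUpperSet (Z : Set (Fin 3 → Bool))) (hV : IsUpperSet (V : Set (Fin 3 → Bool))) :
    0 ≤ (2 - mass w V) * mass w (S ∩ (Y ∪ Z)) + (2 - mass w V) * mass w (Q ∩ (Y ∪ Z) ∩ V)
        - mass w V * (mass w (Q ∩ (Y ∪ Z)) - mass w (Q ∩ (Y ∪ Z) ∩ V)) - mass w (Y ∪ Z) * mass w (K ∩ V)
        + mass w (K ∩ Y ∩ V) + (1 - mass w V) * mass w (K ∩ Y) - (1 - mass w V) * mass w K * mass w (Y ∪ Z)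
        + mass w (Q ∩ Z ∩ V) - mass w K * mass w (Z ∩ V) - mass w Y * mass w (Q ∩ V) - (1 - mass w V) * mass w Y * mass w Q
        - mass w S * (mass w Z - mass w (Z ∩ V)) - mass w S * (mass w (Y ∩ V) - mass w V * mass w Y)
        + (mass w Z - mass w Y) * mass w (S ∩ V) := by
  have hYZ : IsUpperSet ((Y ∪ Z : Finset (Fin 3 → Bool)) : Set (Fin 3 → Bool)) := by
    rw [Finset.coe_union]; exact hY.union hZ
  exact fS_W4_nonneg_of_fkg w hw hfkg hw1 S Q K Y Z V hQS hKS hS hQ hK hY hZ hV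
    (SahiC3Cube.latticeE3_nonneg_cube_three (fun b => hw b) hfkg hQ hYZ hV)

/-- **`F_S ≥ 0` on W4, unconditionally on the block `{0,1}⁴`** (every FKG probability weight; `Q ⊆ S ⊇ K`, `Y, Z, V` up-sets):
the `C₃` instance is `…SahiC3CubeFourFKG.sahiC3_cube_four_fkg`. [this work] -/
theorem fS_W4_nonneg_cube_four (w : (Fin 4 → Bool) → ℝ) (hw : ∀ b, 0 ≤ w b)
    (hfkg : ∀ a b, w a * w b ≤ w (a ⊓ b) * w (a ⊔ b)) (hw1 : ∑ b, w b = 1) (S Q K Y Z V : Finset (Fin 4 → Bool))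
    (hQS : Q ⊆ S) (hKS : K ⊆ S) (hS : IsUpperSet (S : Set (Fin 4 → Bool))) (hQ : IsUpperSet (Q : Set (Fin 4 → Bool)))
    (hK : IsUpperSet (K : Set (Fin 4 → Bool))) (hY : IsUpperSet (Y : Set (Fin 4 → Bool)))
    (hZ : IsUpperSet (Z : Set (Fin 4 → Bool))) (hV : IsUpperSet (V : Set (Fin 4 → Bool))) :
    0 ≤ (2 - mass w V) * mass w (S ∩ (Y ∪ Z)) + (2 - mass w V) * mass w (Q ∩ (Y ∪ Z) ∩ V)
        - mass w V * (mass w (Q ∩ (Y ∪ Z)) - mass w (Q ∩ (Y ∪ Z) ∩ V)) - mass w (Y ∪ Z) * mass w (K ∩ V)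
        + mass w (K ∩ Y ∩ V) + (1 - mass w V) * mass w (K ∩ Y) - (1 - mass w V) * mass w K * mass w (Y ∪ Z)
        + mass w (Q ∩ Z ∩ V) - mass w K * mass w (Z ∩ V) - mass w Y * mass w (Q ∩ V) - (1 - mass w V) * mass w Y * mass w Q
        - mass w S * (mass w Z - mass w (Z ∩ V)) - mass w S * (mass w (Y ∩ V) - mass w V * mass w Y)
        + (mass w Z - mass w Y) * mass w (S ∩ V) := by
  have hYZ : IsUpperSet ((Y ∪ Z : Finset (Fin 4 → Bool)) : Set (Fin 4 → Bool)) := by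
    rw [Finset.coe_union]; exact hY.union hZ
  exact fS_W4_nonneg_of_fkg w hw hfkg hw1 S Q K Y Z V hQS hKS hS hQ hK hY hZ hV
    (SahiC3CubeFourFKG.sahiC3_cube_four_fkg (fun b => hw b) hfkg Q (Y ∪ Z) V hQ hYZ hV)

omit [DecidableEq B] in
/-- **The `D₁` brackets on W4.**  For the two `D₁` blocks (e-brackets MU1q, MU2′ of gen 29) the member `F_S` on W4 exceeds the `D₂`
closed form by `(1−v)(q+s−k)·w(Z)` resp. `(1−v)(s−k)·w(Z)` (verified exactly against the definition, seat `lab/t_w4d1.py`); both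
increments are nonnegative when `k ≤ s` and `v ≤ 1`, so `F_S ≥ 0` on W4 holds for all four mixed blocks.  This lemma records the two
increments' nonnegativity in the form used (any real `F ≥ 0` stays `≥ 0`). [this work] -/
theorem fS_W4_D1_increments_nonneg (w : B → ℝ) (hw : ∀ b, 0 ≤ w b) (hw1 : ∑ b, w b = 1) (S Q K Z V : Finset B)
    (hKS : mass w K ≤ mass w S) {F : ℝ} (hF : 0 ≤ F) :
    0 ≤ F + (1 - mass w V) * (mass w Q + mass w S - mass w K) * mass w Z ∧
      0 ≤ F + (1 - mass w V) * (mass w S - mass w K) * mass w Z := by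
  have hw0 : 0 ≤ w := fun b => hw b
  have hu : mass w univ = 1 := by rw [mass_univ]; exact hw1
  have hv1 : mass w V ≤ 1 := by have := mass_mono hw0 (Finset.subset_univ V); rwa [hu] at this
  have hq : 0 ≤ mass w Q := mass_nonneg hw0 Q
  have hz : 0 ≤ mass w Z := mass_nonneg hw0 Z
  refine ⟨?_, ?_⟩
  · have : 0 ≤ (1 - mass w V) * (mass w Q + mass w S - mass w K) * mass w Z :=
      mul_nonneg (mul_nonneg (sub_nonneg.2 hv1) (by linarith)) hz
    linarith
  · have : 0 ≤ (1 - mass w V) * (mass w S - mass w K) * mass w Z :=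
      mul_nonneg (mul_nonneg (sub_nonneg.2 hv1) (sub_nonneg.2 hKS)) hz
    linarith

end Summit.CriticalPhenomena.PercolationContinuityZ3.Theorems.SahiE3LevelZ2FSW4
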